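import Literature.AlgebraicGeometry.Resolution.RegularLocusPerfectFibre
import Literature.AlgebraicGeometry.Resolution.CompletedPullbackRegular
import Literature.AlgebraicGeometry.Resolution.SmoothLocusBaseChange
import Literature.AlgebraicGeometry.Resolution.SmoothStalksRegular
import Mathlib.AlgebraicGeometry.Morphisms.Smooth
import Mathlib.AlgebraicGeometry.Morphisms.Flat
import Mathlib.AlgebraicGeometry.Morphisms.FinitePresentation
import HarnessLib

/-!
# The regular locus of a perfect-field-valued fibre is the preimage of the smooth locus (schemes)

Topic: `Literature/AlgebraicGeometry/Resolution`. Scheme-level form of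
`RegularLocusPerfectFibre.lean` (Stacks 038X with the fibre criterion 01V8/00TF), for the
fibres `Y ×_{Spec D} Spec k` that occur when a family `q : Y → Spec D` spread out from
characteristic zero is SPECIALIZED at a perfect-field-valued point `D → k`
(`SpreadsShapedFromGenericPoint`, `CanonicalResolutionSpread.lean`;
`BierstoneGrigorievMilmanWlodarczyk2011_embedded`, `EmbeddedResolution.lean`, whose conclusions
refer to the regular locus `Reg` of the INPUT over `k`): for `q` flat and locally of finite
presentation and `k` perfect,

  `Reg(Y ×_{Spec D} Spec k) = pr₁⁻¹(Sm(Y/D))`.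

All PROVED:

* `mem_smoothLocus_iff_isSmoothAt_of_eq_specMap` — dictionary: for `f = Spec(D → B)`, a prime
  `x` of `B` lies in Mathlib's `f.smoothLocus` iff `B` is `D`-smooth at `x`
  (`Algebra.IsSmoothAt`; Mathlib `Scheme.arrowStalkMapSpecIso` and
  `Algebra.FormallySmooth.iff_restrictScalars` along the formally étale `D → D_{x ∩ D}`).
* `isRegularLocalRing_stalk_of_fst_mem_smoothLocus` — **points over the smooth locus are
  regular points of the fibre** (any field `k`, `q` locally of finite presentation): the
  smooth locus only grows under base change (`preimage_smoothLocus_le_smoothLocus_pullback_snd`,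
  `SmoothLocusBaseChange.lean`) and a point of the smooth locus of a `k`-scheme has a regular
  local ring (`isRegularLocalRing_stalk_of_smooth_of_field`, `SmoothStalksRegular.lean`).
* `fst_mem_smoothLocus_of_isRegularLocalRing_stalk` — **regular points of the fibre over a
  PERFECT field lie over the smooth locus** (`q` flat and locally of finite presentation): in
  an affine chart `Spec (Γ(Y, W) ⊗_D k)` of the fibre product (`specTensorChart`,
  `CompletedPullbackRegular.lean`) this is the ring statement
  `isSmoothAt_of_isRegularLocalRing_tensor_perfectField_of_flat`.
* `isRegularLocalRing_stalk_iff_fst_mem_smoothLocus`,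
  `regularLocus_pullback_eq_preimage_smoothLocus` — the equivalence and the equality of sets;
  `isRegularLocalRing_stalk_iff_mem_smoothLocus_of_isPullback` — the same for an arbitrary
  cartesian square `X_k = Y ×_{Spec D} Spec k` (`IsPullback`), the form used with
  `BlowupSequencesBaseChange.lean`.

## Sources

* The Stacks Project, Tag 038X (Varieties, Lemma 33.12.6), Tags 01V8/00TF (fibre criterion of
  smoothness), Tag 056S (smooth over a field ⇒ regular). [StacksProject]
-/

noncomputable section

open CategoryTheory CategoryTheory.Limits AlgebraicGeometry TopologicalSpace TensorProduct

namespace Literature.AlgebraicGeometry.Resolution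

universe u

/-! ## Dictionary: Mathlib's smooth locus of `Spec B → Spec D` and `Algebra.IsSmoothAt` -/

/-- For `f = Spec(D → B)` with `B` of finite presentation over `D`, a prime `x ⊂ B` lies in
`f.smoothLocus` (the stalk map `D_{x ∩ D} → B_x` is formally smooth) iff `B` is `D`-smooth at
`x` (`B_x` formally smooth over `D`): `D → D_{x ∩ D}` is formally étale. [folklore] -/
theorem mem_smoothLocus_iff_isSmoothAt_of_eq_specMap {D B : Type u} [CommRing D] [CommRing B]
    [Algebra D B] (f : Spec (.of B) ⟶ Spec (.of D)) [LocallyOfFinitePresentation f]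
    (hf : f = Spec.map (CommRingCat.ofHom (algebraMap D B))) (x : ↥(Spec (.of B))) :
    x ∈ f.smoothLocus ↔ Algebra.IsSmoothAt D x.asIdeal := by
  subst hf
  rw [Scheme.Hom.mem_smoothLocus,
    RingHom.FormallySmooth.respectsIso.arrow_mk_iso_iff
      (Scheme.arrowStalkMapSpecIso (CommRingCat.ofHom (algebraMap D B)) x)]
  haveI : x.asIdeal.LiesOver (x.asIdeal.under D) := ⟨rfl⟩
  letI := Localization.AtPrime.algebraOfLiesOver (x.asIdeal.under D) x.asIdeal
  have halg : Localization.localRingHom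
      (x.comap (CommRingCat.ofHom (algebraMap D B)).hom).asIdeal x.asIdeal
        (CommRingCat.ofHom (algebraMap D B)).hom rfl =
      algebraMap (Localization.AtPrime (x.asIdeal.under D)) (Localization.AtPrime x.asIdeal) :=
    (Localization.AtPrime.IsLiesOverAlgebra.algebraMap_eq (p := x.asIdeal.under D)
      (P := x.asIdeal)).symm
  change (Localization.localRingHom (x.comap (CommRingCat.ofHom (algebraMap D B)).hom).asIdeal
    x.asIdeal (CommRingCat.ofHom (algebraMap D B)).hom rfl).FormallySmooth ↔ _
  rw [halg]
  exact (RingHom.formallySmooth_algebraMap (R := Localization.AtPrime (x.asIdeal.under D))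
    (S := Localization.AtPrime x.asIdeal)).trans
    (Algebra.FormallySmooth.iff_restrictScalars (R := D)
      (A := Localization.AtPrime (x.asIdeal.under D)) (B := Localization.AtPrime x.asIdeal)).symm

/-! ## Fibres over field-valued points: `Reg(Y ×_{Spec D} Spec k)` and `Sm(Y/D)` -/

section Fibre

variable {D : Type u} [CommRing D] (k : Type u) [Field k] [Algebra D k] {Y : Scheme.{u}}
  (q : Y ⟶ Spec (.of D)) [LocallyOfFinitePresentation q]

/-- **A point of `Y ×_{Spec D} Spec k` over the smooth locus of `q : Y → Spec D` is a regular
point** (any field `k`): it lies in the smooth locus of the projection to `Spec k` (the smooth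
locus only grows under base change), and the local ring at a smooth point of a `k`-scheme is
regular (Stacks 056S). [cite: StacksProject, Tag 056S] -/
theorem isRegularLocalRing_stalk_of_fst_mem_smoothLocus (z : ↑(pullback q (specOfAlgebra D k)))
    (hz : pullback.fst q (specOfAlgebra D k) z ∈ q.smoothLocus) :
    IsRegularLocalRing ((pullback q (specOfAlgebra D k)).presheaf.stalk z) := by
  have hz' : z ∈ (pullback.snd q (specOfAlgebra D k)).smoothLocus :=
    Scheme.Hom.preimage_smoothLocus_le_smoothLocus_pullback_snd q (specOfAlgebra D k) hz
  obtain ⟨U, hzU, hU⟩ := exists_smooth_ι_comp_of_mem_smoothLocus _ hz'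
  haveI := hU
  have h := isRegularLocalRing_stalk_of_smooth_of_field (U.ι ≫ pullback.snd q (specOfAlgebra D k))
    ⟨z, hzU⟩
  exact (isRegularLocalRing_stalk_iff_of_isOpenImmersion U.ι ⟨z, hzU⟩).mpr h

variable [PerfectField k] [Flat q]

/-- **A regular point of the fibre `Y ×_{Spec D} Spec k` over a PERFECT field `k` lies over the
smooth locus of `q : Y → Spec D`**, for `q` flat and locally of finite presentation (Stacks
038X with the fibre criterion 01V8/00TF; no hypothesis on the kernel of `D → k` or on
`k ⊇ κ(ker)`): in an affine chart `Spec (Γ(Y, W) ⊗_D k)` of the fibre product around the point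
this is `isSmoothAt_of_isRegularLocalRing_tensor_perfectField_of_flat`.
[cite: StacksProject, Tag 038X with Tag 00TF] -/
theorem fst_mem_smoothLocus_of_isRegularLocalRing_stalk (z : ↑(pullback q (specOfAlgebra D k)))
    (hz : IsRegularLocalRing ((pullback q (specOfAlgebra D k)).presheaf.stalk z)) :
    pullback.fst q (specOfAlgebra D k) z ∈ q.smoothLocus := by
  classical
  set p₁ := pullback.fst q (specOfAlgebra D k) with hp₁
  -- an affine chart `W ∋ p₁ z` of `Y`, as a `D`-algebra
  obtain ⟨W, hW, hyW, -⟩ := exists_isAffineOpen_mem_and_subset (X := Y) (x := p₁ z) (U := ⊤)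
    trivial
  let iW : Spec Γ(Y, W) ⟶ Y := hW.fromSpec
  let φ : CommRingCat.of D ⟶ Γ(Y, W) := Spec.preimage (iW ≫ q)
  letI : Algebra D Γ(Y, W) := φ.hom.toAlgebra
  have hi : iW ≫ q = Spec.map (CommRingCat.ofHom (algebraMap D Γ(Y, W))) := by
    rw [RingHom.algebraMap_toAlgebra, CommRingCat.ofHom_hom, Spec.map_preimage]
  -- `Γ(Y, W)` is flat and of finite presentation over `D`
  haveI : Algebra.FinitePresentation D Γ(Y, W) := by
    have h1 : LocallyOfFinitePresentation (Spec.map (CommRingCat.ofHom (algebraMap D Γ(Y, W)))) := by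
      rw [← hi]; infer_instance
    exact RingHom.finitePresentation_algebraMap.mp
      ((LocallyOfFinitePresentation.SpecMap_iff _).mp h1)
  haveI : Module.Flat D Γ(Y, W) := by
    have h1 : Flat (Spec.map (CommRingCat.ofHom (algebraMap D Γ(Y, W)))) := by
      rw [← hi]; infer_instance
    exact RingHom.flat_algebraMap_iff.mp (Flat.SpecMap_iff.mp h1)
  -- the chart `Spec (Γ(Y, W) ⊗_D k) → Y ×_D Spec k` contains `z`
  let c := specTensorChart k q iW hi
  have hzc : z ∈ Set.range c := by
    change z ∈ Set.range (specTensorChart k q iW hi)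
    rw [range_specTensorChart, Set.mem_preimage, IsAffineOpen.range_fromSpec]
    exact hyW
  obtain ⟨ζ, hζ⟩ := hzc
  -- `(Γ(Y, W) ⊗_D k)_ζ` is regular
  have hregζ : IsRegularLocalRing (Localization.AtPrime ζ.asIdeal) := by
    rw [← isRegularLocalRing_stalk_Spec_iff, ← isRegularLocalRing_stalk_iff_of_isOpenImmersion c ζ,
      hζ]
    exact hz
  -- pass to `k ⊗_D Γ(Y, W)`
  let e : Γ(Y, W) ⊗[D] k ≃ₐ[D] k ⊗[D] Γ(Y, W) := Algebra.TensorProduct.comm D Γ(Y, W) k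
  let Q : Ideal (k ⊗[D] Γ(Y, W)) := ζ.asIdeal.comap e.symm.toRingEquiv.toRingHom
  haveI hQprime : Q.IsPrime := Ideal.comap_isPrime e.symm.toRingEquiv.toRingHom ζ.asIdeal
  haveI : IsRegularLocalRing (Localization.AtPrime Q) :=
    isRegularLocalRing_localization_comap_ringEquiv e.symm.toRingEquiv ζ.asIdeal
  have hsm := isSmoothAt_of_isRegularLocalRing_tensor_perfectField_of_flat D Γ(Y, W) k Q
  -- the contraction of `Q` to `Γ(Y, W)` is the contraction of `ζ` along `Γ(Y, W) → Γ(Y, W) ⊗ k`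
  let η : ↥(Spec Γ(Y, W)) :=
    PrimeSpectrum.comap (Algebra.TensorProduct.includeLeftRingHom (R := D) (A := Γ(Y, W))
      (B := k)) ζ
  have hQ : Q.comap (Algebra.TensorProduct.includeRight (R := D) (A := k) :
      Γ(Y, W) →ₐ[D] k ⊗[D] Γ(Y, W)).toRingHom = η.asIdeal := by
    ext b
    simp only [Ideal.mem_comap, AlgHom.toRingHom_eq_coe, RingHom.coe_coe,
      Algebra.TensorProduct.includeRight_apply, Q, η, PrimeSpectrum.comap_asIdeal]
    change e.symm ((1 : k) ⊗ₜ[D] b) ∈ ζ.asIdeal ↔ b ⊗ₜ[D] (1 : k) ∈ ζ.asIdeal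
    rw [show e.symm ((1 : k) ⊗ₜ[D] b) = b ⊗ₜ[D] (1 : k) from
      Algebra.TensorProduct.comm_symm_tmul (R := D) b (1 : k)]
  have hηsm : Algebra.IsSmoothAt D η.asIdeal := by
    have key : ∀ (I : Ideal Γ(Y, W)) [I.IsPrime], Q.comap (Algebra.TensorProduct.includeRight
        (R := D) (A := k) : Γ(Y, W) →ₐ[D] k ⊗[D] Γ(Y, W)).toRingHom = I →
        Algebra.IsSmoothAt D I := by
      rintro I _ rfl
      exact hsm
    exact key _ hQ
  -- `η ↦ p₁ z` under the open immersion `iW`, and the smooth locus is local on the source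
  have hη : iW η = p₁ z := by
    have h1 : (c ≫ p₁) ζ = iW η := by
      change (specTensorChart k q iW hi ≫ pullback.fst q (specOfAlgebra D k)) ζ = _
      rw [specTensorChart_fst, Scheme.Hom.comp_apply, Spec.map_apply]
      rfl
    rw [← h1, Scheme.Hom.comp_apply, hζ]
  have h2 : η ∈ (iW ≫ q).smoothLocus :=
    (mem_smoothLocus_iff_isSmoothAt_of_eq_specMap (iW ≫ q) hi η).mpr hηsm
  rw [← Scheme.Hom.preimage_smoothLocus_eq iW q] at h2
  rw [← hη]
  exact h2

/-- **`Reg(Y ×_{Spec D} Spec k) = pr₁⁻¹(Sm(Y/D))`, pointwise**: for `q : Y → Spec D` flat and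
locally of finite presentation and `k` a perfect field, the local ring of `Y ×_{Spec D} Spec k`
at `z` is regular iff `pr₁ z` lies in the smooth locus of `q`.
[cite: StacksProject, Tag 038X with Tags 00TF, 056S] -/
theorem isRegularLocalRing_stalk_iff_fst_mem_smoothLocus (z : ↑(pullback q (specOfAlgebra D k))) :
    IsRegularLocalRing ((pullback q (specOfAlgebra D k)).presheaf.stalk z) ↔
      pullback.fst q (specOfAlgebra D k) z ∈ q.smoothLocus :=
  ⟨fst_mem_smoothLocus_of_isRegularLocalRing_stalk k q z,
    isRegularLocalRing_stalk_of_fst_mem_smoothLocus k q z⟩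

/-- **`Reg(Y ×_{Spec D} Spec k) = pr₁⁻¹(Sm(Y/D))`** as subsets, for `q : Y → Spec D` flat and
locally of finite presentation and `k` a perfect field. In particular the regular locus of the
fibre is open. [cite: StacksProject, Tag 038X with Tags 00TF, 056S] -/
theorem regularLocus_pullback_eq_preimage_smoothLocus :
    {z : ↑(pullback q (specOfAlgebra D k)) |
        IsRegularLocalRing ((pullback q (specOfAlgebra D k)).presheaf.stalk z)} =
      pullback.fst q (specOfAlgebra D k) ⁻¹' (q.smoothLocus : Set Y) :=
  Set.ext fun z => isRegularLocalRing_stalk_iff_fst_mem_smoothLocus k q z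

/-- The same for an arbitrary cartesian square `X_k = Y ×_{Spec D} Spec k` (`IsPullback ι s q
(Spec k → Spec D)`): the local ring of `X_k` at `x` is regular iff `ι x ∈ Sm(Y/D)`.
[cite: StacksProject, Tag 038X with Tags 00TF, 056S] -/
theorem isRegularLocalRing_stalk_iff_mem_smoothLocus_of_isPullback {Xk : Scheme.{u}}
    {ι : Xk ⟶ Y} {s : Xk ⟶ Spec (.of k)} (H : IsPullback ι s q (specOfAlgebra D k)) (x : Xk) :
    IsRegularLocalRing (Xk.presheaf.stalk x) ↔ ι x ∈ q.smoothLocus := by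
  have h1 : ι x = pullback.fst q (specOfAlgebra D k) (H.isoPullback.hom x) := by
    rw [← Scheme.Hom.comp_apply, IsPullback.isoPullback_hom_fst]
  rw [h1, ← isRegularLocalRing_stalk_iff_fst_mem_smoothLocus k q,
    isRegularLocalRing_stalk_iff_of_isOpenImmersion H.isoPullback.hom x]

end Fibre

end Literature.AlgebraicGeometry.Resolution

end
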